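import Literature.MathematicalPhysics.StatisticalMechanics.RootEnergy

/-!
# FrustratedLawDichotomy · crux `AperiodicFrustratedLawGap` (stmt-AtomisticToContinuum-27623) — PHANTOM COMPLETION: the hole-boundary credit
# (decomp-a2c, prover hand 1, generation 50; E′ `hdef` side, the «σ_bad per missing NN bond» row of the σ table, SIGMA-TABLE-hand-1-g50 §4 (P))

The H-side instruments of record (the `…StrainedPatchHom*` family) certify root-energy floors only for CHARTABLE roots — roots whose
window is an affine fcc/hcp image within tolerance.  A root next to a HOLE (one or more vacant kissing sites of its host template) is not
chartable, but its completion by PHANTOM atoms placed on the vacant template sites is.  Since the tree's `rootEnergy V μ = ½ ∫ V ‖y‖ dμ`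
is additive in the configuration measure, the floor of the completed configuration transfers to the real one after subtracting `½ V ‖v‖`
per phantom — and for the Lennard-Jones potential of the tree this is a CREDIT of at least `117/4000 = 0.02925` per phantom at any
template distance `‖v‖ ∈ [93/100, 109/100]` (`181/5000` on `[95/100, 105/100]`, `24/625` on `[24/25, 49/50]`).  This is the certified form of
the desk row «σ_bad ≈ +0.040 per missing NN bond» (pre-registered LIVE line `≥ 0.02`, critic row 1688 (A)).

* §1 `rootEnergy_add_dirac`, `rootEnergy_add_sum_dirac` — `rootEnergy V (μ + Σ_i δ_{v_i}) = rootEnergy V μ + ½ Σ_i V ‖v_i‖` (integrable field);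
  `count_restrict_insert` — `count|(insert v S) = count|S + δ_v` for `v ∉ S` (the configuration reading of one phantom).
* §2 `le_rootEnergy_of_phantoms` — a floor `F` for the completed configuration and `V ‖v_i‖ ≤ −2c` per phantom give `F + #phantoms·c ≤ rootEnergy V μ`.
* §3 Lennard-Jones numerics: `lennardJones_le_of_mem_Icc_93_109` (`V_LJ r ≤ −117/2000` on `[0.93, 1.09]`), `…_95_105` (`≤ −181/2500`), `…_96_98` (`≤ −48/625`),
  via the quadratic `ψ(u) = u²/12 − u/6`, `u = r⁻⁶`, monotone on each side of `u = 1`.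
* §4 ★ `le_rootEnergy_lennardJones_of_phantoms` (+ the two sharper windows): `F ≤ rootEnergy V_LJ (μ + Σ_{i ∈ s} δ_{v_i})`, `‖v_i‖ ∈ [0.93, 1.09]`
  ⟹ `F + #s · 117/4000 ≤ rootEnergy V_LJ μ`.

Consumers: the integrability hypothesis is `…FrustratedLawDichotomyDeletedAtoms.integrable_lennardJones_norm` for rooted hard-core `μ`; the floor `F` of
the completed configuration is any chart floor (HomFloor kit) applied to `μ + Σ δ_{v_i}` — itself a rooted hard-core configuration when the phantoms sit on
vacant template sites.  Def-free; standard axioms.  All `[folklore; bookkeeping + elementary numerics]`.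
-/

noncomputable section

namespace Summit.AtomisticToContinuum.Crystallization.Theorems.FrustratedLawDichotomyPhantomVacancy

open MeasureTheory
open scoped BigOperators ENNReal
open Literature.MathematicalPhysics.StatisticalMechanics (rootEnergy rootEnergy_def lennardJones)

variable {d : ℕ}

/-! ## §1. Root energy is additive in the configuration: adding Dirac atoms -/

/-- **One phantom atom.**  For a field `y ↦ V ‖y‖` integrable against `μ`, adding a unit atom at `v` adds `V ‖v‖ / 2` to the root energy:
`rootEnergy V (μ + δ_v) = rootEnergy V μ + V ‖v‖ / 2`. [folklore] -/
theorem rootEnergy_add_dirac (V : ℝ → ℝ) {μ : Measure (EuclideanSpace ℝ (Fin d))}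
    (hμ : Integrable (fun y : EuclideanSpace ℝ (Fin d) => V ‖y‖) μ) (v : EuclideanSpace ℝ (Fin d)) :
    rootEnergy V (μ + Measure.dirac v) = rootEnergy V μ + V ‖v‖ / 2 := by
  have hv : Integrable (fun y : EuclideanSpace ℝ (Fin d) => V ‖y‖) (Measure.dirac v) := integrable_dirac (by simp)
  rw [rootEnergy_def, rootEnergy_def, integral_add_measure hμ hv, integral_dirac, add_div]

/-- Integrability of the field against finitely many phantom atoms added to `μ`. [folklore] -/
theorem integrable_add_sum_dirac (V : ℝ → ℝ) {μ : Measure (EuclideanSpace ℝ (Fin d))}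
    (hμ : Integrable (fun y : EuclideanSpace ℝ (Fin d) => V ‖y‖) μ) {ι : Type*} (s : Finset ι)
    (v : ι → EuclideanSpace ℝ (Fin d)) :
    Integrable (fun y : EuclideanSpace ℝ (Fin d) => V ‖y‖) (μ + ∑ i ∈ s, Measure.dirac (v i)) :=
  hμ.add_measure (integrable_finsetSum_measure.2 fun _ _ => integrable_dirac (by simp))

/-- **Finitely many phantom atoms.**  `rootEnergy V (μ + Σ_{i ∈ s} δ_{v i}) = rootEnergy V μ + (Σ_{i ∈ s} V ‖v i‖) / 2`. [folklore] -/
theorem rootEnergy_add_sum_dirac (V : ℝ → ℝ) {μ : Measure (EuclideanSpace ℝ (Fin d))}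
    (hμ : Integrable (fun y : EuclideanSpace ℝ (Fin d) => V ‖y‖) μ) {ι : Type*} (s : Finset ι)
    (v : ι → EuclideanSpace ℝ (Fin d)) :
    rootEnergy V (μ + ∑ i ∈ s, Measure.dirac (v i)) = rootEnergy V μ + (∑ i ∈ s, V ‖v i‖) / 2 := by
  classical
  induction s using Finset.induction_on with
  | empty => simp
  | insert a s ha ih =>
    have hint := integrable_add_sum_dirac V hμ s v
    rw [Finset.sum_insert ha, Finset.sum_insert ha, add_comm (Measure.dirac (v a)), ← add_assoc,
      rootEnergy_add_dirac V hint, ih]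
    ring

/-- **Configuration reading of one phantom.**  For a measurable set of atoms `S` and a point `v ∉ S`,
`count|(insert v S) = count|S + δ_v`. [folklore] -/
theorem count_restrict_insert {S : Set (EuclideanSpace ℝ (Fin d))} (hS : MeasurableSet S) {v : EuclideanSpace ℝ (Fin d)}
    (hv : v ∉ S) :
    (Measure.count : Measure (EuclideanSpace ℝ (Fin d))).restrict (insert v S) =
      (Measure.count : Measure (EuclideanSpace ℝ (Fin d))).restrict S + Measure.dirac v := by
  have hdisj : Disjoint ({v} : Set (EuclideanSpace ℝ (Fin d))) S := Set.disjoint_singleton_left.2 hv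
  rw [Set.insert_eq, Measure.restrict_union hdisj hS, Measure.restrict_singleton, Measure.count_singleton, one_smul, add_comm]

/-! ## §2. Floor transfer: a floor for the completed configuration minus the phantom credits -/

/-- **FLOOR TRANSFER.**  If the completed configuration `μ + Σ_{i ∈ s} δ_{v i}` has root energy at least `F` and every phantom contributes
`V ‖v i‖ ≤ −2c`, then `F + #s · c ≤ rootEnergy V μ`. [folklore] -/
theorem le_rootEnergy_of_phantoms (V : ℝ → ℝ) {μ : Measure (EuclideanSpace ℝ (Fin d))}
    (hμ : Integrable (fun y : EuclideanSpace ℝ (Fin d) => V ‖y‖) μ) {ι : Type*} (s : Finset ι)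
    (v : ι → EuclideanSpace ℝ (Fin d)) {F c : ℝ}
    (hfloor : F ≤ rootEnergy V (μ + ∑ i ∈ s, Measure.dirac (v i))) (hc : ∀ i ∈ s, V ‖v i‖ ≤ -(2 * c)) :
    F + s.card * c ≤ rootEnergy V μ := by
  rw [rootEnergy_add_sum_dirac V hμ s v] at hfloor
  have hsum : ∑ i ∈ s, V ‖v i‖ ≤ ∑ i ∈ s, (-(2 * c)) := Finset.sum_le_sum hc
  rw [Finset.sum_const, nsmul_eq_mul] at hsum
  linarith

/-- **One phantom, floor transfer.** [folklore] -/
theorem le_rootEnergy_of_phantom (V : ℝ → ℝ) {μ : Measure (EuclideanSpace ℝ (Fin d))}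
    (hμ : Integrable (fun y : EuclideanSpace ℝ (Fin d) => V ‖y‖) μ) (v : EuclideanSpace ℝ (Fin d)) {F c : ℝ}
    (hfloor : F ≤ rootEnergy V (μ + Measure.dirac v)) (hc : V ‖v‖ ≤ -(2 * c)) : F + c ≤ rootEnergy V μ := by
  rw [rootEnergy_add_dirac V hμ v] at hfloor
  linarith

/-! ## §3. Lennard-Jones numerics: the credit per phantom at template distances -/

/-- `V_LJ r = ψ(u)` with `u = (r⁻¹)⁶`, `ψ(u) = u²/12 − u/6`. [elementary] -/
theorem lennardJones_eq_quad (r : ℝ) : lennardJones r = 1 / 12 * ((r⁻¹) ^ 6) ^ 2 - 1 / 6 * (r⁻¹) ^ 6 := by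
  unfold lennardJones
  ring

/-- `ψ` is non-decreasing on `[1, ∞)`: `1 ≤ u ≤ a ⟹ ψ u ≤ ψ a`. [elementary] -/
theorem quad_le_of_one_le {u a : ℝ} (h1 : 1 ≤ u) (h2 : u ≤ a) :
    1 / 12 * u ^ 2 - 1 / 6 * u ≤ 1 / 12 * a ^ 2 - 1 / 6 * a := by
  nlinarith [mul_nonneg (sub_nonneg.2 h2) (by linarith : (0 : ℝ) ≤ u + a - 2)]

/-- `ψ` is non-increasing on `(0, 1]`: `a ≤ u ≤ 1 ⟹ ψ u ≤ ψ a`. [elementary] -/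
theorem quad_le_of_le_one {u a : ℝ} (h1 : a ≤ u) (h2 : u ≤ 1) :
    1 / 12 * u ^ 2 - 1 / 6 * u ≤ 1 / 12 * a ^ 2 - 1 / 6 * a := by
  nlinarith [mul_nonneg (sub_nonneg.2 h1) (by linarith : (0 : ℝ) ≤ 2 - u - a)]

/-- Upper bound on `u = (r⁻¹)⁶` from a lower bound `b ≤ r` (`0 < b`). [elementary] -/
theorem inv_pow_six_le {r b : ℝ} (hb : 0 < b) (hr : b ≤ r) : (r⁻¹) ^ 6 ≤ (b⁻¹) ^ 6 :=
  pow_le_pow_left₀ (inv_nonneg.2 (hb.le.trans hr)) (inv_anti₀ hb hr) 6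

/-- Lower bound on `u = (r⁻¹)⁶` from an upper bound `r ≤ b` (`0 < r`). [elementary] -/
theorem le_inv_pow_six {r b : ℝ} (hr0 : 0 < r) (hr : r ≤ b) : (b⁻¹) ^ 6 ≤ (r⁻¹) ^ 6 :=
  pow_le_pow_left₀ (inv_nonneg.2 (hr0.le.trans hr)) (inv_anti₀ hr0 hr) 6

/-- **`V_LJ ≤ −117/2000` on `[93/100, 109/100]`** (the per-phantom credit `117/4000 = 0.02925`; desk values `V_LJ(0.93) = −0.05853`,
`V_LJ(1.09) = −0.06975`). [elementary numerics] -/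
theorem lennardJones_le_of_mem_Icc_93_109 {r : ℝ} (h1 : 93 / 100 ≤ r) (h2 : r ≤ 109 / 100) :
    lennardJones r ≤ -(117 / 2000) := by
  rw [lennardJones_eq_quad]
  have hr0 : 0 < r := lt_of_lt_of_le (by norm_num) h1
  rcases le_total r 1 with hle | hge
  · -- compressed side: 1 ≤ u ≤ (100/93)⁶ ≤ 15457/10000
    have hu1 : 1 ≤ (r⁻¹) ^ 6 := one_le_pow₀ ((one_le_inv₀ hr0).2 hle)
    have hu2 : (r⁻¹) ^ 6 ≤ 15457 / 10000 :=
      (inv_pow_six_le (by norm_num) h1).trans (by norm_num)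
    exact (quad_le_of_one_le hu1 hu2).trans (by norm_num)
  · -- stretched side: 5962/10000 ≤ (100/109)⁶ ≤ u ≤ 1
    have hu1 : (r⁻¹) ^ 6 ≤ 1 := pow_le_one₀ (inv_nonneg.2 hr0.le) (inv_le_one_of_one_le₀ hge)
    have hu2 : 5962 / 10000 ≤ (r⁻¹) ^ 6 :=
      le_trans (by norm_num) (le_inv_pow_six hr0 h2)
    exact (quad_le_of_le_one hu2 hu1).trans (by norm_num)

/-- **`V_LJ ≤ −181/2500` on `[95/100, 105/100]`** (credit `181/5000 = 0.0362`; desk `V_LJ(0.95) = −0.07251`, `V_LJ(1.05) = −0.07797`). [elementary numerics] -/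
theorem lennardJones_le_of_mem_Icc_95_105 {r : ℝ} (h1 : 95 / 100 ≤ r) (h2 : r ≤ 105 / 100) :
    lennardJones r ≤ -(181 / 2500) := by
  rw [lennardJones_eq_quad]
  have hr0 : 0 < r := lt_of_lt_of_le (by norm_num) h1
  rcases le_total r 1 with hle | hge
  · have hu1 : 1 ≤ (r⁻¹) ^ 6 := one_le_pow₀ ((one_le_inv₀ hr0).2 hle)
    have hu2 : (r⁻¹) ^ 6 ≤ 13604 / 10000 :=
      (inv_pow_six_le (by norm_num) h1).trans (by norm_num)
    exact (quad_le_of_one_le hu1 hu2).trans (by norm_num)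
  · have hu1 : (r⁻¹) ^ 6 ≤ 1 := pow_le_one₀ (inv_nonneg.2 hr0.le) (inv_le_one_of_one_le₀ hge)
    have hu2 : 7462 / 10000 ≤ (r⁻¹) ^ 6 :=
      le_trans (by norm_num) (le_inv_pow_six hr0 h2)
    exact (quad_le_of_le_one hu2 hu1).trans (by norm_num)

/-- **`V_LJ ≤ −48/625` on the host window `[24/25, 49/50]`** (the fcc/hcp kissing distance `0.9707 ± 0.01`; credit `24/625 = 0.0384`;
desk `V_LJ(0.96) = −0.07691`, `V_LJ(0.98) = −0.08195`). [elementary numerics] -/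
theorem lennardJones_le_of_mem_Icc_96_98 {r : ℝ} (h1 : 24 / 25 ≤ r) (h2 : r ≤ 49 / 50) :
    lennardJones r ≤ -(48 / 625) := by
  rw [lennardJones_eq_quad]
  have hr0 : 0 < r := lt_of_lt_of_le (by norm_num) h1
  have hle : r ≤ 1 := h2.trans (by norm_num)
  have hu1 : 1 ≤ (r⁻¹) ^ 6 := one_le_pow₀ ((one_le_inv₀ hr0).2 hle)
  have hu2 : (r⁻¹) ^ 6 ≤ 12776 / 10000 :=
    (inv_pow_six_le (by norm_num) h1).trans (by norm_num)
  exact (quad_le_of_one_le hu1 hu2).trans (by norm_num)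

/-! ## §4. The certified hole-boundary credit for the Lennard-Jones root energy -/

/-- ★ **HOLE-BOUNDARY CREDIT (template distances `[0.93, 1.09]`).**  If the phantom completion `μ + Σ_{i ∈ s} δ_{v i}` of a configuration `μ`
(Lennard-Jones field integrable against `μ`) has root energy at least `F`, and every phantom sits at distance `‖v i‖ ∈ [93/100, 109/100]` from
the root, then `F + #s · 117/4000 ≤ rootEnergy V_LJ μ`: each vacant kissing site of the root's host template is worth at least `0.02925`.
[folklore; bookkeeping + elementary numerics] -/
theorem le_rootEnergy_lennardJones_of_phantoms {μ : Measure (EuclideanSpace ℝ (Fin d))}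
    (hμ : Integrable (fun y : EuclideanSpace ℝ (Fin d) => lennardJones ‖y‖) μ) {ι : Type*} (s : Finset ι)
    (v : ι → EuclideanSpace ℝ (Fin d)) {F : ℝ}
    (hfloor : F ≤ rootEnergy lennardJones (μ + ∑ i ∈ s, Measure.dirac (v i)))
    (hv : ∀ i ∈ s, 93 / 100 ≤ ‖v i‖ ∧ ‖v i‖ ≤ 109 / 100) :
    F + s.card * (117 / 4000) ≤ rootEnergy lennardJones μ := by
  refine le_rootEnergy_of_phantoms lennardJones hμ s v hfloor fun i hi => ?_
  have h := lennardJones_le_of_mem_Icc_93_109 (hv i hi).1 (hv i hi).2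
  linarith

/-- ★ **HOLE-BOUNDARY CREDIT, window `[0.95, 1.05]`**: `F + #s · 181/5000 ≤ rootEnergy V_LJ μ` (`0.0362` per vacant site). [folklore] -/
theorem le_rootEnergy_lennardJones_of_phantoms_95_105 {μ : Measure (EuclideanSpace ℝ (Fin d))}
    (hμ : Integrable (fun y : EuclideanSpace ℝ (Fin d) => lennardJones ‖y‖) μ) {ι : Type*} (s : Finset ι)
    (v : ι → EuclideanSpace ℝ (Fin d)) {F : ℝ}
    (hfloor : F ≤ rootEnergy lennardJones (μ + ∑ i ∈ s, Measure.dirac (v i)))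
    (hv : ∀ i ∈ s, 95 / 100 ≤ ‖v i‖ ∧ ‖v i‖ ≤ 105 / 100) :
    F + s.card * (181 / 5000) ≤ rootEnergy lennardJones μ := by
  refine le_rootEnergy_of_phantoms lennardJones hμ s v hfloor fun i hi => ?_
  have h := lennardJones_le_of_mem_Icc_95_105 (hv i hi).1 (hv i hi).2
  linarith

/-- ★ **HOLE-BOUNDARY CREDIT, host window `[0.96, 0.98]`**: `F + #s · 24/625 ≤ rootEnergy V_LJ μ` (`0.0384` per vacant kissing site of an
unstrained fcc/hcp host, template distance `0.9707 ± 0.01`). [folklore] -/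
theorem le_rootEnergy_lennardJones_of_phantoms_96_98 {μ : Measure (EuclideanSpace ℝ (Fin d))}
    (hμ : Integrable (fun y : EuclideanSpace ℝ (Fin d) => lennardJones ‖y‖) μ) {ι : Type*} (s : Finset ι)
    (v : ι → EuclideanSpace ℝ (Fin d)) {F : ℝ}
    (hfloor : F ≤ rootEnergy lennardJones (μ + ∑ i ∈ s, Measure.dirac (v i)))
    (hv : ∀ i ∈ s, 24 / 25 ≤ ‖v i‖ ∧ ‖v i‖ ≤ 49 / 50) :
    F + s.card * (24 / 625) ≤ rootEnergy lennardJones μ := by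
  refine le_rootEnergy_of_phantoms lennardJones hμ s v hfloor fun i hi => ?_
  have h := lennardJones_le_of_mem_Icc_96_98 (hv i hi).1 (hv i hi).2
  linarith

/-- **One vacant kissing site, configuration form.**  For a measurable atom set `S` with the Lennard-Jones field integrable against `count|S`
and a point `v ∉ S` at template distance `‖v‖ ∈ [93/100, 109/100]`: a floor `F` for `count|(insert v S)` gives `F + 117/4000 ≤ rootEnergy V_LJ (count|S)`.
[folklore] -/
theorem le_rootEnergy_lennardJones_of_vacantSite {S : Set (EuclideanSpace ℝ (Fin d))} (hS : MeasurableSet S)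
    (hμ : Integrable (fun y : EuclideanSpace ℝ (Fin d) => lennardJones ‖y‖)
      ((Measure.count : Measure (EuclideanSpace ℝ (Fin d))).restrict S))
    {v : EuclideanSpace ℝ (Fin d)} (hv : v ∉ S) (h1 : 93 / 100 ≤ ‖v‖) (h2 : ‖v‖ ≤ 109 / 100) {F : ℝ}
    (hfloor : F ≤ rootEnergy lennardJones ((Measure.count : Measure (EuclideanSpace ℝ (Fin d))).restrict (insert v S))) :
    F + 117 / 4000 ≤ rootEnergy lennardJones ((Measure.count : Measure (EuclideanSpace ℝ (Fin d))).restrict S) := by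
  rw [count_restrict_insert hS hv] at hfloor
  refine le_rootEnergy_of_phantom lennardJones hμ v hfloor ?_
  have h := lennardJones_le_of_mem_Icc_93_109 h1 h2
  linarith

/-! ## §5. Monotone phantom filling in the attractive range (appended, hand-1 g50: CLUSTER-ROWS §B (5))

Beyond the explicit credit windows of §3–§4, ANY phantom at a distance where the potential is non-positive can be added for free: the floor of the
completed configuration transfers with credit `≥ 0`.  For the tree's Lennard-Jones potential `V_LJ r ≤ 0 ⟺ (r⁻¹)⁶ ≤ 2` (`lennardJones_nonpos_iff`),
in particular for every `r ≥ 9/10` (used inline; cf. `…NearFarGlueR.lennardJones_nonpos_of_ge_nine_tenths`).  So a hole template may be completed at ALL its vacant sites (second and third shells included) before the chart floor is applied, paying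
credits only where §4 grants them. -/

/-- **Free phantoms.**  If the field is `ν`-a.e. non-positive (and integrable against `μ` and `ν`), adding `ν` can only LOWER the root energy:
`rootEnergy V (μ + ν) ≤ rootEnergy V μ` — equivalently a floor for `μ + ν` is a floor for `μ`. [folklore] -/
theorem rootEnergy_add_le_of_nonpos (V : ℝ → ℝ) {μ ν : Measure (EuclideanSpace ℝ (Fin d))}
    (hμ : Integrable (fun y : EuclideanSpace ℝ (Fin d) => V ‖y‖) μ) (hν : Integrable (fun y : EuclideanSpace ℝ (Fin d) => V ‖y‖) ν)
    (hle : ∀ᵐ y ∂ν, V ‖y‖ ≤ 0) : rootEnergy V (μ + ν) ≤ rootEnergy V μ := by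
  rw [rootEnergy_def, rootEnergy_def, integral_add_measure hμ hν]
  have h : ∫ y, V ‖y‖ ∂ν ≤ 0 := integral_nonpos_of_ae hle
  linarith

/-- **Free phantoms, floor form.**  `F ≤ rootEnergy V (μ + ν)` with `V ‖·‖ ≤ 0` `ν`-a.e. gives `F ≤ rootEnergy V μ`. [folklore] -/
theorem le_rootEnergy_of_nonpos_phantoms (V : ℝ → ℝ) {μ ν : Measure (EuclideanSpace ℝ (Fin d))}
    (hμ : Integrable (fun y : EuclideanSpace ℝ (Fin d) => V ‖y‖) μ) (hν : Integrable (fun y : EuclideanSpace ℝ (Fin d) => V ‖y‖) ν)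
    (hle : ∀ᵐ y ∂ν, V ‖y‖ ≤ 0) {F : ℝ} (hfloor : F ≤ rootEnergy V (μ + ν)) : F ≤ rootEnergy V μ :=
  hfloor.trans (rootEnergy_add_le_of_nonpos V hμ hν hle)

/-- **Sign of the Lennard-Jones potential**: for `r > 0`, `V_LJ r ≤ 0 ↔ (r⁻¹)⁶ ≤ 2` (i.e. `r ≥ 2^{-1/6} ≈ 0.8909`). [elementary] -/
theorem lennardJones_nonpos_iff {r : ℝ} (hr : 0 < r) : lennardJones r ≤ 0 ↔ (r⁻¹) ^ 6 ≤ 2 := by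
  rw [lennardJones_eq_quad]
  have hu : 0 < (r⁻¹) ^ 6 := pow_pos (inv_pos.2 hr) 6
  constructor
  · intro h
    nlinarith [h, hu]
  · intro h
    nlinarith [h, hu]

/-- ★ **FREE PHANTOMS for Lennard-Jones**: adding finitely many phantom atoms all at distance `≥ 9/10` from the root lowers (weakly) the root energy:
`rootEnergy V_LJ (μ + Σ_{i ∈ s} δ_{v i}) ≤ rootEnergy V_LJ μ`.  Combine with §4: complete a hole template at ALL vacant sites, collect `117/4000` per
kissing-distance phantom (§4) and `0` for the rest. [folklore] -/
theorem rootEnergy_lennardJones_add_sum_dirac_le {μ : Measure (EuclideanSpace ℝ (Fin d))}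
    (hμ : Integrable (fun y : EuclideanSpace ℝ (Fin d) => lennardJones ‖y‖) μ) {ι : Type*} (s : Finset ι)
    (v : ι → EuclideanSpace ℝ (Fin d)) (hv : ∀ i ∈ s, 9 / 10 ≤ ‖v i‖) :
    rootEnergy lennardJones (μ + ∑ i ∈ s, Measure.dirac (v i)) ≤ rootEnergy lennardJones μ := by
  rw [rootEnergy_add_sum_dirac lennardJones hμ s v]
  -- `V_LJ ‖v i‖ ≤ 0` from `9/10 ≤ ‖v i‖` via `lennardJones_nonpos_iff` (`(10/9)⁶ ≤ 2`); the tree also has this fact as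
  -- `…PhononSlackCertificatesNearFarGlueR.lennardJones_nonpos_of_ge_nine_tenths` (heavy import chain, deliberately not imported here).
  have hsum : ∑ i ∈ s, lennardJones ‖v i‖ ≤ 0 := Finset.sum_nonpos fun i hi =>
    (lennardJones_nonpos_iff (lt_of_lt_of_le (by norm_num) (hv i hi))).2 ((inv_pow_six_le (by norm_num) (hv i hi)).trans (by norm_num))
  linarith

/-- ★ **TWO-TIER PHANTOM FLOOR**: phantoms `v i` (`i ∈ s`) at kissing distances `[93/100, 109/100]` earn `117/4000` each, phantoms `w j` (`j ∈ t`) anywhere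
at distance `≥ 9/10` earn `0`; a floor `F` for the fully completed configuration gives `F + #s · 117/4000 ≤ rootEnergy V_LJ μ`. [folklore] -/
theorem le_rootEnergy_lennardJones_of_phantoms_twoTier {μ : Measure (EuclideanSpace ℝ (Fin d))}
    (hμ : Integrable (fun y : EuclideanSpace ℝ (Fin d) => lennardJones ‖y‖) μ) {ι κ : Type*} (s : Finset ι) (t : Finset κ)
    (v : ι → EuclideanSpace ℝ (Fin d)) (w : κ → EuclideanSpace ℝ (Fin d)) {F : ℝ}
    (hfloor : F ≤ rootEnergy lennardJones ((μ + ∑ i ∈ s, Measure.dirac (v i)) + ∑ j ∈ t, Measure.dirac (w j)))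
    (hv : ∀ i ∈ s, 93 / 100 ≤ ‖v i‖ ∧ ‖v i‖ ≤ 109 / 100) (hw : ∀ j ∈ t, 9 / 10 ≤ ‖w j‖) :
    F + s.card * (117 / 4000) ≤ rootEnergy lennardJones μ := by
  have hμs := integrable_add_sum_dirac lennardJones hμ s v
  have h1 : F ≤ rootEnergy lennardJones (μ + ∑ i ∈ s, Measure.dirac (v i)) :=
    hfloor.trans (rootEnergy_lennardJones_add_sum_dirac_le hμs t w hw)
  exact le_rootEnergy_lennardJones_of_phantoms hμ s v h1 hv

end Summit.AtomisticToContinuum.Crystallization.Theorems.FrustratedLawDichotomyPhantomVacancy
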